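import Summits.Ventures.PercRepro.C026Pendant
import Summits.Ventures.PercRepro.C026ForestA

/-!
# C-026 (class form) on every forest (mine-3 dossier §13, Theorem 13.1) — the induction (p5, gen 7)

Continuation of `C026ForestA.lean` (split for the ≤ 400-line lint): the multigraph `G − v` (`minus`, `extClosed`), the transport
of connectivity and of `(CF)` between `G − v` and the star-closed configurations of `G` (`conn_minus_iff`,
`cf_minus_iff`), forests (`IsForest`: every vertex-deleted sub-multigraph with an edge has a leaf; stable under
`minus`), and the induction on the number of edges — **`cf_forest`**: `(CF)` on every forest, for every three
distinct marks (Lemma P_a for a leaf mark `a` or `b`, `pendant_reduction` for a leaf `c`, `scaling_reduction` for a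
leaf non-mark).
-/

namespace PercRepro

open Finset

namespace MultiGraph

variable {V E : Type*} (G : MultiGraph V E)

/-! ### The multigraph `G − v` and the transport of `(CF)` -/

section Minus

open Classical in
/-- **`G − v`**: the multigraph on the same vertices whose edges are the edges of `G` away from `v`. -/
noncomputable def minus (v : V) : MultiGraph V (G.Rest v) where
  fst e := G.fst e.1
  snd e := G.snd e.1

open Classical in
/-- A configuration of `G − v`, extended by the closed star at `v`. -/
noncomputable def extClosed (v : V) (ρ : Config (G.Rest v)) : Config E :=
  (G.starSplit v).symm (fun _ => false, ρ)

open Classical in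
/-- The extension on a star edge. -/
theorem extClosed_apply_of_mem (v : V) (ρ : Config (G.Rest v)) {e : E} (he : e ∈ G.edgesAt ({v} : Set V)) :
    G.extClosed v ρ e = false :=
  G.starSplit_symm_apply_of_mem v _ ρ he

open Classical in
/-- The extension away from the star. -/
theorem extClosed_apply_of_notMem (v : V) (ρ : Config (G.Rest v)) {e : E} (he : e ∉ G.edgesAt ({v} : Set V)) :
    G.extClosed v ρ e = ρ ⟨e, he⟩ :=
  G.starSplit_symm_apply_of_notMem v _ ρ he

open Classical in
/-- The extension has the star closed. -/
theorem starClosed_extClosed (v : V) (ρ : Config (G.Rest v)) : G.StarClosed v (G.extClosed v ρ) :=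
  (G.starClosed_starSplit_symm_iff v _ ρ).2 rfl

open Classical in
/-- **Connectivity transports** between `G − v` and the star-closed extension. -/
theorem conn_minus_iff (v : V) (ρ : Config (G.Rest v)) (u u' : V) :
    (G.minus v).Conn ρ u u' ↔ G.Conn (G.extClosed v ρ) u u' := by
  unfold Conn
  constructor
  · intro h
    induction h with
    | refl => exact Relation.ReflTransGen.refl
    | tail _ hxy ih =>
      obtain ⟨e, he, hxy⟩ := hxy
      refine ih.tail ⟨e.1, ?_, hxy⟩
      rw [G.extClosed_apply_of_notMem v ρ e.2]
      exact he
  · intro h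
    induction h with
    | refl => exact Relation.ReflTransGen.refl
    | tail _ hxy ih =>
      obtain ⟨e, he, hxy⟩ := hxy
      by_cases hv : e ∈ G.edgesAt ({v} : Set V)
      · rw [G.extClosed_apply_of_mem v ρ hv] at he
        exact absurd he (by decide)
      · refine ih.tail ⟨⟨e, hv⟩, ?_, hxy⟩
        rw [G.extClosed_apply_of_notMem v ρ hv] at he
        exact he

open Classical in
/-- The complement of the extension, with the star closed again, is the extension of the complement. -/
theorem closeStar_compl_extClosed (v : V) (ρ : Config (G.Rest v)) :
    G.closeStar v (G.extClosed v ρ)ᶜ = G.extClosed v ρᶜ := by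
  funext e
  by_cases hv : e ∈ G.edgesAt ({v} : Set V)
  · rw [G.closeStar_apply_of_mem hv, G.extClosed_apply_of_mem v _ hv]
  · rw [G.closeStar_apply_of_notMem hv, compl_apply_not, G.extClosed_apply_of_notMem v _ hv,
      G.extClosed_apply_of_notMem v _ hv, compl_apply_not]

open Classical in
/-- **Connectivity in the complement transports** for vertices other than the pendant `v`. -/
theorem conn_compl_minus_iff {v w : V} (hp : G.Pendant v w) (hvw : v ≠ w) (ρ : Config (G.Rest v))
    {u u' : V} (hu : u ≠ v) (hu' : u' ≠ v) :
    (G.minus v).Conn ρᶜ u u' ↔ G.Conn (G.extClosed v ρ)ᶜ u u' := by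
  rw [G.conn_minus_iff, ← G.closeStar_compl_extClosed, ← G.conn_closeStar_iff hp hvw hu hu']

variable [Fintype E] [DecidableEq E]

open Classical in
/-- **The counts transport**: a star-closed count on `G` is a count on `G − v`. -/
theorem card_starClosed_eq_card_minus (v : V) (P : Config E → Prop) [DecidablePred P] :
    (Finset.univ.filter fun S : Config E => G.StarClosed v S ∧ P S).card =
      (Finset.univ.filter fun ρ : Config (G.Rest v) => P (G.extClosed v ρ)).card := by
  rw [G.card_filter_eq_sum_split v (fun S => G.StarClosed v S ∧ P S), Finset.card_filter]
  apply Finset.sum_congr rfl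
  intro ρ _
  rw [← sum_star_closed (α := G.Star v → Bool) (fun _ => false) (P (G.extClosed v ρ))]
  apply Finset.sum_congr rfl
  intro σ _
  rw [G.starClosed_starSplit_symm_iff]
  by_cases hσ : σ = fun _ => false
  · subst hσ
    by_cases hP : P (G.extClosed v ρ)
    · rw [if_pos ⟨rfl, hP⟩, if_pos ⟨rfl, hP⟩]
    · rw [if_neg (fun h => hP h.2), if_neg (fun h => hP h.2)]
  · rw [if_neg (fun h => hσ h.1), if_neg (fun h => hσ h.1)]

open Classical in
/-- **`(CF)` transports**: for `v` pendant and three marks other than `v`, the star-closed inequality on `G`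
(the right side of `pendant_reduction` / `scaling_reduction`) is `(CF)` on `G − v`. -/
theorem cf_minus_iff {v w : V} (hp : G.Pendant v w) (hvw : v ≠ w) {a b c : V} (ha : a ≠ v) (hb : b ≠ v)
    (hc : c ≠ v) :
    ((Finset.univ.filter fun S : Config E => G.StarClosed v S ∧ G.Conn S a b ∧ G.IsCIso Sᶜ a b c).card ≤
        (Finset.univ.filter fun S : Config E => G.StarClosed v S ∧ G.OnePair S a b c).card) ↔
      (G.minus v).CF a b c := by
  unfold CF
  rw [G.card_starClosed_eq_card_minus v (fun S => G.Conn S a b ∧ G.IsCIso Sᶜ a b c),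
    G.card_starClosed_eq_card_minus v (fun S => G.OnePair S a b c)]
  have h1 : ∀ ρ : Config (G.Rest v), (G.Conn (G.extClosed v ρ) a b ∧ G.IsCIso (G.extClosed v ρ)ᶜ a b c) ↔
      ((G.minus v).Conn ρ a b ∧ (G.minus v).IsCIso ρᶜ a b c) := by
    intro ρ
    unfold IsCIso
    rw [G.conn_minus_iff, G.conn_compl_minus_iff hp hvw ρ ha hc, G.conn_compl_minus_iff hp hvw ρ hb hc]
  have h2 : ∀ ρ : Config (G.Rest v), G.OnePair (G.extClosed v ρ) a b c ↔ (G.minus v).OnePair ρ a b c := by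
    intro ρ
    unfold OnePair
    rw [G.conn_minus_iff, G.conn_minus_iff, G.conn_minus_iff]
  rw [Finset.filter_congr (fun ρ _ => h1 ρ), Finset.filter_congr (fun ρ _ => h2 ρ)]

end Minus

/-! ### Forests -/

/-- **A leaf away from `D`**: `v, w ∉ D`, `v ≠ w`, and the only edge at `v` avoiding `D` is a single edge `f`
joining `v` and `w`. -/
def IsLeafOff (D : Set V) (v w : V) : Prop :=
  v ∉ D ∧ w ∉ D ∧ v ≠ w ∧ ∃ f, G.fst f ∉ D ∧ G.snd f ∉ D ∧
    ((G.fst f = v ∧ G.snd f = w) ∨ (G.fst f = w ∧ G.snd f = v)) ∧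
    ∀ e, G.fst e ∉ D → G.snd e ∉ D → (G.fst e = v ∨ G.snd e = v) → e = f

/-- **A forest**: after deleting any set `D` of vertices (with their edges), a multigraph that still has an
edge has a leaf.  (Every acyclic multigraph has this property; it is the form the induction uses.) -/
def IsForest : Prop :=
  ∀ D : Set V, (∃ e, G.fst e ∉ D ∧ G.snd e ∉ D) → ∃ v w, G.IsLeafOff D v w

/-- A leaf away from `∅` is a leaf. -/
theorem IsLeafOff.isLeaf {v w : V} (h : G.IsLeafOff ∅ v w) : G.IsLeaf v w := by
  obtain ⟨-, -, hvw, f, -, -, hf, huniq⟩ := h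
  exact ⟨hvw, f, hf, fun e he => huniq e (Set.notMem_empty _) (Set.notMem_empty _) he⟩

open Classical in
/-- An edge of `G − v` is an edge of `G` away from `v`. -/
theorem minus_fst_ne (v : V) (e : G.Rest v) : (G.minus v).fst e ≠ v ∧ (G.minus v).snd e ≠ v := by
  have he := e.2
  simp only [edgesAt, Set.mem_setOf_eq, Set.mem_singleton_iff, not_or] at he
  exact he

open Classical in
/-- **A forest stays a forest under `minus`.** -/
theorem IsForest.minus (hF : G.IsForest) (v : V) : (G.minus v).IsForest := by
  intro D ⟨e, he1, he2⟩
  obtain ⟨hne1, hne2⟩ := G.minus_fst_ne v e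
  obtain ⟨v', w', hv', hw', hvw', f, hf1, hf2, hf, huniq⟩ := hF (insert v D)
    ⟨e.1, by simp only [Set.mem_insert_iff, not_or]; exact ⟨hne1, he1⟩,
      by simp only [Set.mem_insert_iff, not_or]; exact ⟨hne2, he2⟩⟩
  simp only [Set.mem_insert_iff, not_or] at hv' hw' hf1 hf2
  have hfstar : f ∉ G.edgesAt ({v} : Set V) := by
    simp only [edgesAt, Set.mem_setOf_eq, Set.mem_singleton_iff, not_or]
    exact ⟨hf1.1, hf2.1⟩
  refine ⟨v', w', hv'.2, hw'.2, hvw', ⟨f, hfstar⟩, hf1.2, hf2.2, hf, ?_⟩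
  intro e' he'1 he'2 he'v
  obtain ⟨hne'1, hne'2⟩ := G.minus_fst_ne v e'
  apply Subtype.ext
  exact huniq e'.1 (by simp only [Set.mem_insert_iff, not_or]; exact ⟨hne'1, he'1⟩)
    (by simp only [Set.mem_insert_iff, not_or]; exact ⟨hne'2, he'2⟩) he'v

open Classical in
/-- `(CF)` on a multigraph without edges (`a ≠ b` are never joined). -/
theorem cf_of_isEmpty [Fintype E] [DecidableEq E] (hE : IsEmpty E) {a b c : V} (hab : a ≠ b) :
    G.CF a b c := by
  unfold CF
  have : (Finset.univ.filter fun S : Config E => G.Conn S a b ∧ G.IsCIso Sᶜ a b c) = ∅ := by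
    apply Finset.filter_eq_empty_iff.2
    intro S _ h
    apply hab
    have h' := h.1
    unfold Conn at h'
    induction h' with
    | refl => rfl
    | tail _ hxy _ =>
      obtain ⟨e, -, -⟩ := hxy
      exact hE.elim e
  rw [this, Finset.card_empty]
  exact Nat.zero_le _

open Classical in
/-- **C-026 (class form) on every forest** (mine-3 §13, Theorem 13.1), by induction on the number of edges:
a forest with an edge has a leaf `v` with its single edge to `w`; `v = a` or `v = b` is Lemma P_a
(`cf_of_leaf_a`), `v = c` is Lemma P_c (`pendant_reduction`, the mark moves to `w`), a pendant non-mark is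
Lemma P_v (`scaling_reduction`); the star-closed statement is `(CF)` on the forest `G − v` (`cf_minus_iff`). -/
theorem cf_forest_aux : ∀ (n : ℕ) {E : Type*} [Fintype E] [DecidableEq E] (G : MultiGraph V E),
    Fintype.card E ≤ n → G.IsForest → ∀ a b c : V, a ≠ b → a ≠ c → b ≠ c → G.CF a b c := by
  intro n
  induction n with
  | zero =>
    intro E _ _ G hE _ a b c hab _ _
    exact G.cf_of_isEmpty (Fintype.card_eq_zero_iff.1 (Nat.le_zero.1 hE)) hab
  | succ n ih =>
    intro E _ _ G hE hF a b c hab hac hbc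
    by_cases hne : IsEmpty E
    · exact G.cf_of_isEmpty hne hab
    rw [not_isEmpty_iff] at hne
    obtain ⟨e₀⟩ := hne
    obtain ⟨v, w, hl⟩ := hF ∅ ⟨e₀, Set.notMem_empty _, Set.notMem_empty _⟩
    have hleaf : G.IsLeaf v w := MultiGraph.IsLeafOff.isLeaf G hl
    have hp : G.Pendant v w := hleaf.pendant
    have hvw : v ≠ w := hleaf.1
    obtain ⟨f, hf, -⟩ := hleaf.2
    have hfstar : f ∈ G.edgesAt ({v} : Set V) := (MultiGraph.IsLeaf.mem_star_iff G hleaf hf f).2 rfl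
    have hcard : Fintype.card (G.Rest v) ≤ n := by
      have hlt : Fintype.card (G.Rest v) < Fintype.card E := by
        convert Fintype.card_subtype_lt (p := fun e => e ∉ G.edgesAt ({v} : Set V)) (x := f)
          (by simpa using hfstar)
      omega
    have hF' : (G.minus v).IsForest := MultiGraph.IsForest.minus G hF v
    by_cases hva : v = a
    · subst hva
      exact G.cf_of_leaf_a hleaf hab hac
    by_cases hvb : v = b
    · subst hvb
      exact (G.cf_swap a v c).2 (G.cf_of_leaf_a hleaf (Ne.symm hab) hbc)
    by_cases hvc : v = c
    · subst hvc
      have h1 : G.CF a b v ↔ _ := G.pendant_reduction hp hvw (Ne.symm hva) (Ne.symm hvb)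
      rw [h1, G.cf_minus_iff hp hvw (Ne.symm hva) (Ne.symm hvb) (Ne.symm hvw)]
      by_cases hwa : w = a
      · subst hwa
        exact (G.minus v).cf_of_eq_left _ _
      by_cases hwb : w = b
      · subst hwb
        exact (G.minus v).cf_of_eq_right _ _
      exact ih (G.minus v) hcard hF' a b w hab (Ne.symm hwa) (Ne.symm hwb)
    · have h1 : G.CF a b c ↔ _ := G.scaling_reduction hp hvw (Ne.symm hva) (Ne.symm hvb) (Ne.symm hvc)
      rw [h1, G.cf_minus_iff hp hvw (Ne.symm hva) (Ne.symm hvb) (Ne.symm hvc)]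
      exact ih (G.minus v) hcard hF' a b c hab hac hbc

open Classical in
/-- **C-026 (class form) on every forest, for every three distinct marks** (mine-3 §13, Theorem 13.1). -/
theorem cf_forest [Fintype E] [DecidableEq E] (hF : G.IsForest) {a b c : V} (hab : a ≠ b) (hac : a ≠ c)
    (hbc : b ≠ c) : G.CF a b c :=
  cf_forest_aux (Fintype.card E) G le_rfl hF a b c hab hac hbc

end MultiGraph

end PercRepro
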